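import Summits.HubbardSuperconductivity.HubbardSuperconductivity.Theses.ChiralWindow
import Literature.Barriers.HubbardSuperconductivity.PureModelStripeCompetition
import Literature.MathematicalPhysics.QuantumLattice.DWaveOrderParameterProofs

/-!
# Crux `CwSsbToEvenTorusLRO` (item `stmt-HubbardSuperconductivity-10439`): window uniformity —
what route ChiralWindow actually needs from the transfer, and what it cannot borrow

Support file of the standing disprover (generation 1; workfile
`Cruxes/CwSsbToEvenTorusLRO/Disproof.lean`). No definition is introduced: the three atoms are spelled out —
density matching `Tendsto (L ↦ Re ω₀(N̂)/(L+1)²) atTop (𝓝 (1-δ))` for the tracial grand-canonical ground state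
of `hubbardTorusWith 2 (L+1) 1 U μ`, the Koma–Tasaki order parameter `dWaveOrderParameter U μ`, and the summit
matrix `HasDWavePairFieldLROAt U δ` (by `Iff.rfl` the conclusion the route file inlines). Proved:

* `cwSsbToEvenTorusLRO_imp_windowTransfer` — the crux implies the δ-UNIFORM WINDOW TRANSFER
  `∀ C > 0, ∃ U₀, ∀ U ∈ (0,U₀), ∀ δ ∈ [3/10,12/25], ∀ μ, density matching → exp(-C/U²) ≤ m(U,μ) → matrix`,
  which is all the route's glue `CwChiralConstruction → CwSsbToEvenTorusLRO → CwThesis` consumes (the glue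
  from the window transfer is eight lines, kept in the workfile because it concludes a Theses decl): the doping
  range outside the window, bare positivity of `m` instead of crux 2's floor, and `C`-independence of `U₀` are
  not used by the route.
* `swapped_glue_not_formal` — the quantifier-SWAPPED transfer `∀ δ, ∃ U₀(δ), ∀ U < U₀(δ), …` (which suffices
  for route WeakCouplingBCS, whose construction fixes `δ` before `U₀`) does NOT yield the thesis shape of THIS
  route from the construction shape of its crux 2 by logic: an interpretation of the three atoms (order
  parameter in `[0, 4√2]` as in the tree) satisfies the swapped transfer on all of `(0,1/2)` and the
  construction shape while the thesis shape fails — a doping `δ_U = 3/10 + U` sliding with the coupling, as the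
  Kohn–Luttinger crossing line does. Route ChiralWindow needs δ-uniformity of the coupling window.
* `windowTransfer_consistent_with_not_uniform` — conversely the window transfer is (abstractly) consistent with
  failure of the crux's uniform-on-`(0,1/2)` form: a refutation of the crux at a doping outside `[3/10,12/25]`
  would be a misstatement for this route (repair: the window transfer).
* `eventually_forall_of_forall_eventually_prod`, `windowTransfer_iff_locallyUniform` — by compactness of the
  window, uniformity on `[3/10,12/25]` is EQUIVALENT to local uniformity (a product neighbourhood
  `(0,U₀(δ₀)) × (δ₀-ε, δ₀+ε)` at each `δ₀` of the window): pinning `δ_U → δ*` in crux 2 would shrink the range,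
  not the kind, of uniformity required.
* `pairOrderRigidity_of_eventuallySimple` — the every-ground-state sub-obligation (asymptotic equality of the
  `d`-wave pair-order density over the source-free `(N_L, S^z=0)` sector ground states, necessary for any
  transfer proof through a quenched corner) follows with spread `0` from eventual simplicity of the sector
  ground energy along even sides — the expected situation in the gapped chiral `d + iχ*` phase (`ℤ₂` doublet
  tunnel-split).
-/

noncomputable section

namespace Summit.HubbardSuperconductivity.HubbardSuperconductivity.Theorems.CwSsbToEvenTorusLRO.Negative

open Literature.MathematicalPhysics.QuantumLattice Literature.Barriers.HubbardSuperconductivity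
open Filter Set
open scoped Matrix ComplexOrder
open _root_.Topology
open Summit.HubbardSuperconductivity.HubbardSuperconductivity.Theses.ChiralWindow (CwSsbToEvenTorusLRO)

/-! ### 1. The window transfer is implied by the crux -/

/-- `[3/10, 12/25] ⊂ (0, 1/2)`. [folklore] -/
theorem window_subset_Ioo : Icc (3 / 10 : ℝ) (12 / 25) ⊆ Ioo (0:ℝ) (1 / 2) := fun _ hδ =>
  ⟨by linarith [hδ.1], by linarith [hδ.2]⟩

/-- **The crux implies the δ-uniform window transfer with crux 2's floor** (doping cut to the window,
`exp(-C/U²) ≤ m` in place of `0 < m`, `U₀` allowed to depend on `C`). [folklore] -/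
theorem cwSsbToEvenTorusLRO_imp_windowTransfer (h : CwSsbToEvenTorusLRO) :
    ∀ C : ℝ, 0 < C → ∃ U₀ : ℝ, 0 < U₀ ∧ ∀ U ∈ Ioo (0:ℝ) U₀, ∀ δ ∈ Icc (3 / 10 : ℝ) (12 / 25), ∀ μ : ℝ,
      Tendsto (fun L : ℕ => ((hubbardTorusWith 2 (L + 1) 1 U μ).groundStateFunctional totalNumber).re /
          ((L + 1 : ℕ) : ℝ) ^ 2) atTop (𝓝 (1 - δ)) →
        Real.exp (-C / U ^ 2) ≤ dWaveOrderParameter U μ → HasDWavePairFieldLROAt U δ := by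
  obtain ⟨U₀, hU₀, h⟩ := h
  intro C _
  refine ⟨U₀, hU₀, fun U hU δ hδ μ hdm hfloor => h U hU δ (window_subset_Ioo hδ) μ hdm ?_⟩
  exact (hasDWaveOrder_iff U μ).2 (lt_of_lt_of_le (Real.exp_pos _) hfloor)

/-! ### 2. The swapped transfer does not glue (abstract independence), and the window transfer is
consistent with failure of the uniform form -/

/-- **`swapped_glue_not_formal`.** For SOME interpretation of the atoms `D` (density matching), `m` (order
parameter, valued in `[0, 4√2]`) and `M` (matrix): the swapped transfer holds on all of `(0, 1/2)`, the
construction shape of crux 2 holds, and the thesis shape fails. Witness: `D U δ μ := (δ = 3/10 + U)`,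
`m := 1`, `M := False`. [folklore] -/
theorem swapped_glue_not_formal :
    ∃ (D : ℝ → ℝ → ℝ → Prop) (m : ℝ → ℝ → ℝ) (M : ℝ → ℝ → Prop),
      (∀ U μ, 0 ≤ m U μ ∧ m U μ ≤ 4 * Real.sqrt 2) ∧
        (∀ δ ∈ Ioo (0:ℝ) (1 / 2), ∃ U₀ : ℝ, 0 < U₀ ∧ ∀ U ∈ Ioo (0:ℝ) U₀, ∀ μ : ℝ,
            D U δ μ → 0 < m U μ → M U δ) ∧
          (∃ U₀ : ℝ, 0 < U₀ ∧ ∃ C : ℝ, 0 < C ∧ ∀ U ∈ Ioo (0:ℝ) U₀,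
              ∃ δ ∈ Icc (3 / 10 : ℝ) (12 / 25), ∃ μ : ℝ, D U δ μ ∧ Real.exp (-C / U ^ 2) ≤ m U μ) ∧
            ¬ (∃ U₀ : ℝ, 0 < U₀ ∧ ∀ U ∈ Ioo (0:ℝ) U₀, ∃ δ ∈ Icc (3 / 10 : ℝ) (12 / 25), M U δ) := by
  refine ⟨fun U δ _ => δ = 3 / 10 + U, fun _ _ => 1, fun _ _ => False, fun _ _ => ⟨zero_le_one, ?_⟩,
    ?_, ?_, ?_⟩
  · show (1:ℝ) ≤ 4 * Real.sqrt 2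
    nlinarith [Real.sq_sqrt (show (0:ℝ) ≤ 2 by norm_num), Real.sqrt_nonneg 2]
  · intro δ _
    by_cases hle : δ ≤ 3 / 10
    · exact ⟨1, one_pos, fun U hU _ hD _ => by dsimp only at hD ⊢; linarith [hU.1]⟩
    · push Not at hle
      exact ⟨δ - 3 / 10, by linarith, fun U hU _ hD _ => by dsimp only at hD ⊢; linarith [hU.2]⟩
  · refine ⟨9 / 50, by norm_num, 1, one_pos, fun U hU =>
      ⟨3 / 10 + U, ⟨by linarith [hU.1], by linarith [hU.2]⟩, 0, rfl, ?_⟩⟩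
    show Real.exp (-1 / U ^ 2) ≤ 1
    exact Real.exp_le_one_iff.2 (div_nonpos_iff.2 (Or.inr ⟨by norm_num, sq_nonneg U⟩))
  · rintro ⟨U₀, hU₀, h⟩
    obtain ⟨δ, -, hM⟩ := h (U₀ / 2) ⟨by linarith, by linarith⟩
    exact hM

/-- **`windowTransfer_consistent_with_not_uniform`.** For SOME interpretation of the atoms the window
transfer holds while the uniform-on-`(0,1/2)` form fails (witness: `M U δ := δ ∈ [3/10,12/25]`, `D := True`,
`m := 1`; failure at `δ = 1/10`). [folklore] -/
theorem windowTransfer_consistent_with_not_uniform :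
    ∃ (D : ℝ → ℝ → ℝ → Prop) (m : ℝ → ℝ → ℝ) (M : ℝ → ℝ → Prop),
      (∀ C : ℝ, 0 < C → ∃ U₀ : ℝ, 0 < U₀ ∧ ∀ U ∈ Ioo (0:ℝ) U₀, ∀ δ ∈ Icc (3 / 10 : ℝ) (12 / 25), ∀ μ : ℝ,
          D U δ μ → Real.exp (-C / U ^ 2) ≤ m U μ → M U δ) ∧
        ¬ (∃ U₀ : ℝ, 0 < U₀ ∧ ∀ U ∈ Ioo (0:ℝ) U₀, ∀ δ ∈ Ioo (0:ℝ) (1 / 2), ∀ μ : ℝ,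
            D U δ μ → 0 < m U μ → M U δ) := by
  refine ⟨fun _ _ _ => True, fun _ _ => 1, fun _ δ => δ ∈ Icc (3 / 10 : ℝ) (12 / 25), ?_, ?_⟩
  · intro C _
    exact ⟨1, one_pos, fun U _ δ hδ _ _ _ => hδ⟩
  · rintro ⟨U₀, hU₀, h⟩
    have := h (U₀ / 2) ⟨by linarith, by linarith⟩ (1 / 10) ⟨by norm_num, by norm_num⟩ 0 trivial one_pos
    exact absurd this.1 (by norm_num)

/-! ### 3. Local uniformity in `δ` is uniformity on the window (compactness) -/

/-- General topology: an `eventually` statement uniform over a compact parameter set follows from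
product-neighbourhood statements at each parameter, for ANY filter in the first factor (Mathlib's
`IsCompact.eventually_forall_of_forall_eventually` is the case `l = 𝓝 x₀`). [folklore] -/
theorem eventually_forall_of_forall_eventually_prod {X Y : Type*} [TopologicalSpace Y] {l : Filter X}
    {K : Set Y} (hK : IsCompact K) {P : X → Y → Prop}
    (hP : ∀ y ∈ K, ∀ᶠ z : X × Y in l ×ˢ 𝓝 y, P z.1 z.2) : ∀ᶠ x in l, ∀ y ∈ K, P x y := by
  simp only [← eventually_iSup, ← hK.prod_nhdsSet_eq_biSup] at hP
  exact hP.curry.mono fun _ h ↦ h.self_of_nhdsSet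

/-- **`windowTransfer_iff_locallyUniform`**: for any body `B : ℝ → ℝ → Prop` (here: the window transfer's
`∀ μ, density matching → floor → matrix` at scale `C`), "`∃ U₀, ∀ U ∈ (0,U₀), ∀ δ ∈ [3/10,12/25], B U δ`" is
equivalent to "at every `δ₀ ∈ [3/10,12/25]`, `B` holds on a product neighbourhood in `(𝓝[>] 0) ×ˢ 𝓝 δ₀`
(for dopings inside the window)". [folklore] -/
theorem windowTransfer_iff_locallyUniform (B : ℝ → ℝ → Prop) :
    (∃ U₀ : ℝ, 0 < U₀ ∧ ∀ U ∈ Ioo (0:ℝ) U₀, ∀ δ ∈ Icc (3 / 10 : ℝ) (12 / 25), B U δ) ↔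
      ∀ δ₀ ∈ Icc (3 / 10 : ℝ) (12 / 25), ∀ᶠ z : ℝ × ℝ in (𝓝[>] (0:ℝ)) ×ˢ 𝓝 δ₀,
        z.2 ∈ Icc (3 / 10 : ℝ) (12 / 25) → B z.1 z.2 := by
  have key : (∃ U₀ : ℝ, 0 < U₀ ∧ ∀ U ∈ Ioo (0:ℝ) U₀, ∀ δ ∈ Icc (3 / 10 : ℝ) (12 / 25), B U δ) ↔
      ∀ᶠ U in 𝓝[>] (0:ℝ), ∀ δ ∈ Icc (3 / 10 : ℝ) (12 / 25), B U δ :=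
    ⟨fun ⟨U₀, hU₀, h⟩ => (nhdsGT_basis (0:ℝ)).eventually_iff.2 ⟨U₀, hU₀, fun U hU => h U hU⟩, fun h => by
      obtain ⟨U₀, hU₀, h⟩ := (nhdsGT_basis (0:ℝ)).eventually_iff.1 h
      exact ⟨U₀, hU₀, fun U hU => h hU⟩⟩
  rw [key]
  constructor
  · intro h δ₀ _
    exact (h.prod_inl (𝓝 δ₀)).mono fun z hz hz2 => hz z.2 hz2
  · intro h
    exact (eventually_forall_of_forall_eventually_prod
      (P := fun U δ => δ ∈ Icc (3 / 10 : ℝ) (12 / 25) → B U δ) isCompact_Icc h).mono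
      fun U hU δ hδ => hU δ hδ hδ

/-! ### 4. The every-ground-state sub-obligation from eventual simplicity -/

/-- `⟨cφ, A cφ⟩ = c̄c ⟨φ, A φ⟩`. [folklore] -/
theorem expect_smul {L : ℕ} (A : Matrix (Finset (Orb (FermionTorus 2 L))) (Finset (Orb (FermionTorus 2 L))) ℂ)
    (c : ℂ) (φ : Fock (Orb (FermionTorus 2 L))) :
    expect A (c • φ) = (starRingEnd ℂ c * c) * expect A φ := by
  rw [expect, expect, Matrix.mulVec_smul, star_smul, smul_dotProduct, dotProduct_smul, smul_eq_mul,
    smul_eq_mul, ← mul_assoc, Complex.star_def]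

/-- `⟨cφ, cφ⟩ = c̄c ⟨φ, φ⟩`. [folklore] -/
theorem star_smul_dotProduct_smul {L : ℕ} (c : ℂ) (φ : Fock (Orb (FermionTorus 2 L))) :
    star (c • φ) ⬝ᵥ (c • φ) = (starRingEnd ℂ c * c) * (star φ ⬝ᵥ φ) := by
  rw [star_smul, smul_dotProduct, dotProduct_smul, smul_eq_mul, smul_eq_mul, ← mul_assoc, Complex.star_def]

/-- `c̄c = |c|²` is real. [folklore] -/
theorem conj_mul_re_im (c : ℂ) : (starRingEnd ℂ c * c).re = ‖c‖ ^ 2 ∧ (starRingEnd ℂ c * c).im = 0 := by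
  rw [Complex.conj_mul', ← Complex.ofReal_pow]
  exact ⟨Complex.ofReal_re _, Complex.ofReal_im _⟩

/-- **`pairOrderRigidity_of_eventuallySimple`.** If along even sides `L ≥ L₀` any two `(N_L, S^z = 0)`-sector
ground states of `hubbardTorus 2 L 1 U`, `N_L = 2⌊(1-δ)L²/2⌋`, are proportional, then all normalised sector
ground states have the SAME `d`-wave pair-order density `L⁻⁴ Re⟨ψ, P†P ψ⟩` (`P = pairField dWaveFormFactor L`);
in particular the pair-order rigidity sub-obligation holds for every `ε > 0`. [folklore] -/
theorem pairOrderRigidity_of_eventuallySimple {U δ : ℝ} {L₀ : ℕ}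
    (h : ∀ (L : ℕ) [NeZero L], L₀ ≤ L → Even L → ∀ ψ ψ' : Fock (Orb (FermionTorus 2 L)),
      IsGroundStateInSector (hubbardTorus 2 L 1 U) (2 * ⌊(1 - δ) * (L : ℝ) ^ 2 / 2⌋₊) 0 ψ →
      IsGroundStateInSector (hubbardTorus 2 L 1 U) (2 * ⌊(1 - δ) * (L : ℝ) ^ 2 / 2⌋₊) 0 ψ' →
        ∃ c : ℂ, ψ' = c • ψ)
    (L : ℕ) [NeZero L] (hL : L₀ ≤ L) (hev : Even L) (ψ ψ' : Fock (Orb (FermionTorus 2 L)))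
    (hψ : IsGroundStateInSector (hubbardTorus 2 L 1 U) (2 * ⌊(1 - δ) * (L : ℝ) ^ 2 / 2⌋₊) 0 ψ)
    (hψn : star ψ ⬝ᵥ ψ = 1)
    (hψ' : IsGroundStateInSector (hubbardTorus 2 L 1 U) (2 * ⌊(1 - δ) * (L : ℝ) ^ 2 / 2⌋₊) 0 ψ')
    (hψ'n : star ψ' ⬝ᵥ ψ' = 1) :
    (expect ((pairField dWaveFormFactor L)ᴴ * pairField dWaveFormFactor L) ψ').re / (L : ℝ) ^ 4 =
      (expect ((pairField dWaveFormFactor L)ᴴ * pairField dWaveFormFactor L) ψ).re / (L : ℝ) ^ 4 := by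
  obtain ⟨c, rfl⟩ := h L hL hev ψ ψ' hψ hψ'
  have hc : ‖c‖ ^ 2 = 1 := by
    have h1 := star_smul_dotProduct_smul c ψ
    rw [hψn, mul_one, hψ'n] at h1
    have := congrArg Complex.re h1
    rw [(conj_mul_re_im c).1] at this
    simpa using this.symm
  rw [expect_smul, Complex.mul_re, (conj_mul_re_im c).1, (conj_mul_re_im c).2, zero_mul, sub_zero, hc, one_mul]

end Summit.HubbardSuperconductivity.HubbardSuperconductivity.Theorems.CwSsbToEvenTorusLRO.Negative

end
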